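import Literature.NumberTheory.Automorphic.GL2CEquivariantPrimitive
import HarnessLib

/-!
# Growth of the equivariant primitive on `GL₂(ℂ)`: a cochain of polynomial growth has a primitive
# of polynomial growth

Topic `NumberTheory/Automorphic`; namespace `Literature.NumberTheory.Automorphic.GL2C` (the
vocabulary of `GL2CUpperHalfSpaceCalculus` / `GL2CEquivariantPrimitive`: `Mat = M₂(ℂ)` with the
`L^∞`-operator norm `Matrix.Norms.Operator`, `Inv = {det ≠ 0}`, the orbit map `proj : M₂(ℂ) → ℍ³`,
the Iwasawa section `sec`, the pushed-down form `formAt`, `potential`, `primitive`).  Theorems only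
(no definition, no named fact, no `sorry`).

**The estimate.**  Measure the size of an invertible matrix by `s(M) = 1 + ‖M‖ + ‖M⁻¹‖` (any
gauge equivalent to the archimedean height `max (|M_{ij}|, |(M⁻¹)_{ij}|)` would do;
`norm_primitive_le_of_entry_le` is the entrywise form).  If the cochain `f : 𝔭₀ → Fun(GL₂(ℂ), V)` has
POLYNOMIAL GROWTH, `‖f (X_v) M'‖ ≤ B ‖v‖ s(M')^k` for all invertible `M'` and all tangent vectors
`v ∈ ℂ × ℝ ≅ 𝔭₀` — the shape of `X ↦ (g ↦ E(g) Φ_X(g))` for an algebraic coefficient representation `E`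
and bounded (cusp) forms `Φ_X` — then its primitive `F = primitive f` (the radial integral of the
pushed-down closed `1`-form from the base point `j = (0, 1)` of `ℍ³`, pulled back along `proj`) has
polynomial growth with constants depending on `B`, `k` only, LINEARLY on `B`:

  `‖primitive f M‖ ≤ 2 · 13^k · 4^{2k+2} · B · s(M)^{8k+8}`   (`norm_primitive_le`).

This is the growth input of the non-vanishing of the Eichler–Shimura–Harder class of a non-zero
harmonic cuspidal cochain (`GL2CVanEst.vanEstClass_eq_zero_iff`, `KugaDegreeOneInjectivity`,
`AutomorphicLieDerivSkewAdjointArchGrowth`: the invariant primitive must have moderate growth in the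
archimedean variable for the integration by parts against cusp forms).  No closedness, equivariance
or smoothness of `f` is used: only the pointwise bound at the points `sec q` of the section.

**Proof** (elementary; [folklore] — the crude polynomial version of the growth conditions on
forms and primitives behind Borel's injectivity theorem, cf. [cite: BorelWallach2000, XIV 2.3]
("the complex `C*_log` … defined in terms of growth conditions at the corners", PDF p. 299)).
For `M ∈ Inv` with `(z, r) = proj M = ((M₀₁ M̄₁₁ + M₀₀ M̄₁₀) / D, |det M| / D)`,
`D = |M₁₁|² + |M₁₀|²` (`proj_eq`): the row `(M M⁻¹)₁₁ = 1` gives `D ≥ 1 / (2 s²)`, and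
`|det M|, |det M|⁻¹ = |det M⁻¹| ≤ 2 s²`, so `r, 1/r, |z| ≤ A := 4 s⁴` (§2).  Along the segment
`q_t = (t z, 1 + t (r - 1))`, `t ∈ [0, 1]`, from `j` to `(z, r)` one has `q_t.2 ∈ [min(1,r), max(1,r)]`,
so the section `sec q_t = (√r_t, z_t/√r_t; 0, 1/√r_t)` and its inverse `(1/√r_t, -z_t/√r_t; 0, √r_t)`
have `s(sec q_t) ≤ 13 A²` (§3); the integrand of `potential` is
`(2 r_t)⁻¹ f (X_{(z, r-1)}) (sec q_t)`, of norm `≤ A · B · 2A · (13 A²)^k` (§4), and the interval has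
length `1`.

## References

* A. Borel, N. Wallach, *Continuous cohomology, discrete subgroups, and representations of
  reductive groups*, 2nd ed., Math. Surveys Monogr. 67 (2000), XIV 2.3 (growth conditions and the
  injectivity of harmonic forms into the cohomology of the arithmetic group; held, PDF p. 299)
  [BorelWallach2000].
* G. Harder, *Eisenstein cohomology of arithmetic groups. The case GL₂*, Invent. Math. 89
  (1987), §3.1 (the Eichler–Shimura–Harder map; not held, context) [Harder1987].
* J. Elstrodt, F. Grunewald, J. Mennicke, *Groups Acting on Hyperbolic Space* (1998), Ch. 1 §1.1
  (the coordinates `proj`, `sec`) [ElstrodtGrunewaldMennicke1998].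
-/

noncomputable section

open Matrix Complex Set Filter MeasureTheory
open scoped MatrixGroups ComplexConjugate Matrix.Norms.Operator Topology Classical Interval

namespace Literature.NumberTheory.Automorphic

namespace GL2C

variable {V : Type*} [NormedAddCommGroup V] [NormedSpace ℝ V]

/-! ### 1. The `L^∞`-operator norm on `M₂(ℂ)` against entries -/

/-- An entry is bounded by the `L^∞`-operator norm: `‖M i j‖ ≤ ‖M‖ = max_i ∑_j ‖M i j‖`.
[folklore] -/
theorem norm_apply_le_norm (M : Mat) (i j : Fin 2) : ‖M i j‖ ≤ ‖M‖ := by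
  have h1 : ‖M i j‖₊ ≤ ∑ j', ‖M i j'‖₊ :=
    Finset.single_le_sum (f := fun j' => ‖M i j'‖₊) (fun _ _ => zero_le) (Finset.mem_univ j)
  have h2 : (∑ j', ‖M i j'‖₊) ≤ Finset.univ.sup fun i' : Fin 2 => ∑ j', ‖M i' j'‖₊ :=
    Finset.le_sup (f := fun i' : Fin 2 => ∑ j', ‖M i' j'‖₊) (Finset.mem_univ i)
  rw [Matrix.linfty_opNorm_def]
  exact_mod_cast h1.trans h2

/-- The `L^∞`-operator norm is bounded by any common bound of the row sums. [folklore] -/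
theorem norm_le_of_forall_row_sum_le (M : Mat) {c : ℝ} (hc : 0 ≤ c)
    (h : ∀ i, ∑ j, ‖M i j‖ ≤ c) : ‖M‖ ≤ c := by
  rw [Matrix.linfty_opNorm_def]
  have key : (Finset.univ.sup fun i : Fin 2 => ∑ j, ‖M i j‖₊) ≤ c.toNNReal :=
    Finset.sup_le fun i _ => by
      show (∑ j, ‖M i j‖₊) ≤ c.toNNReal
      rw [← NNReal.coe_le_coe, NNReal.coe_sum, Real.coe_toNNReal _ hc]
      simpa only [coe_nnnorm] using h i
  calc ((Finset.univ.sup fun i : Fin 2 => ∑ j, ‖M i j‖₊ : NNReal) : ℝ) ≤ (c.toNNReal : ℝ) :=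
        NNReal.coe_le_coe.2 key
    _ = c := Real.coe_toNNReal _ hc

/-- For a `2 × 2` matrix, `‖M‖ ≤ 2 H` when all entries have norm `≤ H`. [folklore] -/
theorem norm_le_two_mul_of_entry_le (M : Mat) {H : ℝ} (hH : 0 ≤ H) (h : ∀ i j, ‖M i j‖ ≤ H) :
    ‖M‖ ≤ 2 * H := by
  refine norm_le_of_forall_row_sum_le M (by positivity) fun i => ?_
  rw [Fin.sum_univ_two]
  linarith [h i 0, h i 1]

/-! ### 2. Invertible matrices: determinant, denominator and the coordinates `(z, r) = proj M`
against `s(M) = 1 + ‖M‖ + ‖M⁻¹‖` -/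

section MatrixBounds

variable {M : Mat}

/-- `1 ≤ s(M)`. [folklore] -/
theorem one_le_size (M : Mat) : 1 ≤ 1 + ‖M‖ + ‖M⁻¹‖ := by
  have h1 := norm_nonneg M
  have h2 := norm_nonneg M⁻¹
  linarith

/-- Entries of `M` are `≤ s(M)`. [folklore] -/
theorem norm_apply_le_size (M : Mat) (i j : Fin 2) : ‖M i j‖ ≤ 1 + ‖M‖ + ‖M⁻¹‖ := by
  have := norm_apply_le_norm M i j
  have h2 := norm_nonneg M⁻¹
  linarith

/-- Entries of `M⁻¹` are `≤ s(M)`. [folklore] -/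
theorem norm_inv_apply_le_size (M : Mat) (i j : Fin 2) : ‖M⁻¹ i j‖ ≤ 1 + ‖M‖ + ‖M⁻¹‖ := by
  have := norm_apply_le_norm M⁻¹ i j
  have h2 := norm_nonneg M
  linarith

/-- `|det M| ≤ 2 s(M)²`. [folklore] -/
theorem norm_det_le_size (M : Mat) : ‖M.det‖ ≤ 2 * (1 + ‖M‖ + ‖M⁻¹‖) ^ 2 := by
  set s := 1 + ‖M‖ + ‖M⁻¹‖ with hs
  have hs1 : 1 ≤ s := one_le_size M
  rw [Matrix.det_fin_two]
  have h00 := norm_apply_le_size M 0 0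
  have h01 := norm_apply_le_size M 0 1
  have h10 := norm_apply_le_size M 1 0
  have h11 := norm_apply_le_size M 1 1
  calc ‖M 0 0 * M 1 1 - M 0 1 * M 1 0‖ ≤ ‖M 0 0 * M 1 1‖ + ‖M 0 1 * M 1 0‖ := norm_sub_le _ _
    _ = ‖M 0 0‖ * ‖M 1 1‖ + ‖M 0 1‖ * ‖M 1 0‖ := by rw [norm_mul, norm_mul]
    _ ≤ s * s + s * s := add_le_add
        (mul_le_mul h00 h11 (norm_nonneg _) (zero_le_one.trans hs1))
        (mul_le_mul h01 h10 (norm_nonneg _) (zero_le_one.trans hs1))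
    _ = 2 * s ^ 2 := by ring

/-- `1 ≤ 2 s(M)² |det M|` for `M` invertible (`|det M|⁻¹ = |det M⁻¹| ≤ 2 s(M⁻¹)² = 2 s(M)²`).
[folklore] -/
theorem one_le_size_sq_mul_norm_det (hM : M ∈ Inv) :
    1 ≤ 2 * (1 + ‖M‖ + ‖M⁻¹‖) ^ 2 * ‖M.det‖ := by
  have hM' : IsUnit M.det := hM
  have hdet : ‖M.det‖ * ‖M⁻¹.det‖ = 1 := by
    rw [← norm_mul, ← Matrix.det_mul, Matrix.mul_nonsing_inv M hM', Matrix.det_one, norm_one]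
  have hinv : ‖M⁻¹.det‖ ≤ 2 * (1 + ‖M‖ + ‖M⁻¹‖) ^ 2 := by
    have := norm_det_le_size M⁻¹
    rwa [Matrix.nonsing_inv_nonsing_inv M hM', add_right_comm] at this
  calc (1 : ℝ) = ‖M.det‖ * ‖M⁻¹.det‖ := hdet.symm
    _ ≤ ‖M.det‖ * (2 * (1 + ‖M‖ + ‖M⁻¹‖) ^ 2) := mul_le_mul_of_nonneg_left hinv (norm_nonneg _)
    _ = 2 * (1 + ‖M‖ + ‖M⁻¹‖) ^ 2 * ‖M.det‖ := by ring

/-- The denominator `D = |M₁₁|² + |M₁₀|²` of `proj` is `≤ 2 s(M)²`. [folklore] -/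
theorem denom_le_size (M : Mat) :
    normSq (M 1 1) + normSq (M 1 0) ≤ 2 * (1 + ‖M‖ + ‖M⁻¹‖) ^ 2 := by
  set s := 1 + ‖M‖ + ‖M⁻¹‖ with hs
  have hs1 : 1 ≤ s := one_le_size M
  have h10 := norm_apply_le_size M 1 0
  have h11 := norm_apply_le_size M 1 1
  rw [Complex.normSq_eq_norm_sq, Complex.normSq_eq_norm_sq]
  have a : ‖M 1 1‖ ^ 2 ≤ s ^ 2 := pow_le_pow_left₀ (norm_nonneg _) h11 2
  have b : ‖M 1 0‖ ^ 2 ≤ s ^ 2 := pow_le_pow_left₀ (norm_nonneg _) h10 2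
  linarith

/-- **The denominator is not small**: `1 ≤ 2 s(M)² D` for `M` invertible — the entry
`(M M⁻¹)₁₁ = M₁₀ (M⁻¹)₀₁ + M₁₁ (M⁻¹)₁₁ = 1` gives `1 ≤ s (|M₁₀| + |M₁₁|)`, and
`(|M₁₀| + |M₁₁|)² ≤ 2 D`. [folklore] -/
theorem one_le_size_sq_mul_denom (hM : M ∈ Inv) :
    1 ≤ 2 * (1 + ‖M‖ + ‖M⁻¹‖) ^ 2 * (normSq (M 1 1) + normSq (M 1 0)) := by
  have hM' : IsUnit M.det := hM
  set s := 1 + ‖M‖ + ‖M⁻¹‖ with hs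
  have hs1 : 1 ≤ s := one_le_size M
  have hs0 : 0 ≤ s := zero_le_one.trans hs1
  -- the entry `(1,1)` of `M M⁻¹ = 1`
  have hrow : M 1 0 * M⁻¹ 0 1 + M 1 1 * M⁻¹ 1 1 = 1 := by
    have := congr_fun (congr_fun (Matrix.mul_nonsing_inv M hM') 1) 1
    simpa [Matrix.mul_apply, Fin.sum_univ_two] using this
  have hsum : 1 ≤ s * (‖M 1 0‖ + ‖M 1 1‖) := by
    have i01 := norm_inv_apply_le_size M 0 1
    have i11 := norm_inv_apply_le_size M 1 1
    calc (1 : ℝ) = ‖M 1 0 * M⁻¹ 0 1 + M 1 1 * M⁻¹ 1 1‖ := by rw [hrow, norm_one]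
      _ ≤ ‖M 1 0‖ * ‖M⁻¹ 0 1‖ + ‖M 1 1‖ * ‖M⁻¹ 1 1‖ := by
          refine (norm_add_le _ _).trans ?_
          rw [norm_mul, norm_mul]
      _ ≤ ‖M 1 0‖ * s + ‖M 1 1‖ * s := add_le_add
          (mul_le_mul_of_nonneg_left i01 (norm_nonneg _))
          (mul_le_mul_of_nonneg_left i11 (norm_nonneg _))
      _ = s * (‖M 1 0‖ + ‖M 1 1‖) := by ring
  rw [Complex.normSq_eq_norm_sq, Complex.normSq_eq_norm_sq]
  have ha := norm_nonneg (M 1 0)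
  have hb := norm_nonneg (M 1 1)
  -- `1 ≤ s² (a + b)² ≤ 2 s² (a² + b²)`
  have h1 : 1 ≤ (s * (‖M 1 0‖ + ‖M 1 1‖)) ^ 2 := by
    have := pow_le_pow_left₀ zero_le_one hsum 2
    rwa [one_pow] at this
  nlinarith [sq_nonneg (‖M 1 0‖ - ‖M 1 1‖), sq_nonneg s]

/-- **The height coordinate is polynomially bounded**: `r = (proj M).2 ≤ 4 s(M)⁴`. [folklore] -/
theorem proj_snd_le_size (hM : M ∈ Inv) : (proj M).2 ≤ 4 * (1 + ‖M‖ + ‖M⁻¹‖) ^ 4 := by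
  have hM' : IsUnit M.det := hM
  set s := 1 + ‖M‖ + ‖M⁻¹‖ with hs
  have hs1 : 1 ≤ s := one_le_size M
  have hD := denom_pos hM'
  have hD1 := one_le_size_sq_mul_denom hM
  have hdet := norm_det_le_size M
  rw [proj_eq hM']
  change ‖M.det‖ / (normSq (M 1 1) + normSq (M 1 0)) ≤ 4 * s ^ 4
  rw [div_le_iff₀ hD]
  -- `|det| ≤ 2 s² = 2 s² · 1 ≤ 2 s² · 2 s² D`
  have hs2 : 0 ≤ 2 * s ^ 2 := by positivity
  calc ‖M.det‖ ≤ 2 * s ^ 2 := hdet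
    _ = 2 * s ^ 2 * 1 := (mul_one _).symm
    _ ≤ 2 * s ^ 2 * (2 * s ^ 2 * (normSq (M 1 1) + normSq (M 1 0))) :=
        mul_le_mul_of_nonneg_left hD1 hs2
    _ = 4 * s ^ 4 * (normSq (M 1 1) + normSq (M 1 0)) := by ring

/-- **… and so is its inverse**: `1 ≤ 4 s(M)⁴ r`. [folklore] -/
theorem one_le_size_mul_proj_snd (hM : M ∈ Inv) : 1 ≤ 4 * (1 + ‖M‖ + ‖M⁻¹‖) ^ 4 * (proj M).2 := by
  have hM' : IsUnit M.det := hM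
  set s := 1 + ‖M‖ + ‖M⁻¹‖ with hs
  have hs1 : 1 ≤ s := one_le_size M
  have hD := denom_pos hM'
  have hDle := denom_le_size M
  have hdet1 := one_le_size_sq_mul_norm_det hM
  rw [proj_eq hM']
  change 1 ≤ 4 * s ^ 4 * (‖M.det‖ / (normSq (M 1 1) + normSq (M 1 0)))
  rw [mul_div_assoc', le_div_iff₀ hD, one_mul]
  have hs2 : 0 ≤ 2 * s ^ 2 := by positivity
  calc normSq (M 1 1) + normSq (M 1 0) ≤ 2 * s ^ 2 := hDle
    _ = 2 * s ^ 2 * 1 := (mul_one _).symm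
    _ ≤ 2 * s ^ 2 * (2 * s ^ 2 * ‖M.det‖) := mul_le_mul_of_nonneg_left hdet1 hs2
    _ = 4 * s ^ 4 * ‖M.det‖ := by ring

/-- **The horizontal coordinate is polynomially bounded**: `|z| = |(proj M).1| ≤ 4 s(M)⁴`.
[folklore] -/
theorem norm_proj_fst_le_size (hM : M ∈ Inv) : ‖(proj M).1‖ ≤ 4 * (1 + ‖M‖ + ‖M⁻¹‖) ^ 4 := by
  have hM' : IsUnit M.det := hM
  set s := 1 + ‖M‖ + ‖M⁻¹‖ with hs
  have hs1 : 1 ≤ s := one_le_size M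
  have hs0 : 0 ≤ s := zero_le_one.trans hs1
  have hD := denom_pos hM'
  have hD1 := one_le_size_sq_mul_denom hM
  rw [proj_eq hM']
  change ‖(M 0 1 * conj (M 1 1) + M 0 0 * conj (M 1 0)) /
      ((normSq (M 1 1) : ℂ) + (normSq (M 1 0) : ℂ))‖ ≤ 4 * s ^ 4
  have hden : ((normSq (M 1 1) : ℂ) + (normSq (M 1 0) : ℂ)) =
      ((normSq (M 1 1) + normSq (M 1 0) : ℝ) : ℂ) := by push_cast; ring
  rw [hden, norm_div, Complex.norm_real, Real.norm_eq_abs, abs_of_pos hD, div_le_iff₀ hD]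
  have h00 := norm_apply_le_size M 0 0
  have h01 := norm_apply_le_size M 0 1
  have h10 := norm_apply_le_size M 1 0
  have h11 := norm_apply_le_size M 1 1
  have hnum : ‖M 0 1 * conj (M 1 1) + M 0 0 * conj (M 1 0)‖ ≤ 2 * s ^ 2 := by
    calc ‖M 0 1 * conj (M 1 1) + M 0 0 * conj (M 1 0)‖
        ≤ ‖M 0 1 * conj (M 1 1)‖ + ‖M 0 0 * conj (M 1 0)‖ := norm_add_le _ _
      _ = ‖M 0 1‖ * ‖M 1 1‖ + ‖M 0 0‖ * ‖M 1 0‖ := by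
          rw [norm_mul, norm_mul, Complex.norm_conj, Complex.norm_conj]
      _ ≤ s * s + s * s := add_le_add (mul_le_mul h01 h11 (norm_nonneg _) hs0)
          (mul_le_mul h00 h10 (norm_nonneg _) hs0)
      _ = 2 * s ^ 2 := by ring
  have hs2 : 0 ≤ 2 * s ^ 2 := by positivity
  calc ‖M 0 1 * conj (M 1 1) + M 0 0 * conj (M 1 0)‖ ≤ 2 * s ^ 2 := hnum
    _ = 2 * s ^ 2 * 1 := (mul_one _).symm
    _ ≤ 2 * s ^ 2 * (2 * s ^ 2 * (normSq (M 1 1) + normSq (M 1 0))) :=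
        mul_le_mul_of_nonneg_left hD1 hs2
    _ = 4 * s ^ 4 * (normSq (M 1 1) + normSq (M 1 0)) := by ring

end MatrixBounds

/-! ### 3. The Iwasawa section: inverse and size -/

/-- **The inverse of the section**: `(sec (z, r))⁻¹ = (1/√r, -z/√r; 0, √r)` for `r > 0`.
[cite: ElstrodtGrunewaldMennicke1998, Ch. 1 §1.1] -/
theorem sec_inv_eq {p : ℂ × ℝ} (hp : 0 < p.2) :
    (sec p)⁻¹ = !![1 / ((Real.sqrt p.2 : ℝ) : ℂ), -p.1 / ((Real.sqrt p.2 : ℝ) : ℂ);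
      0, ((Real.sqrt p.2 : ℝ) : ℂ)] := by
  have hs : ((Real.sqrt p.2 : ℝ) : ℂ) ≠ 0 := ofReal_ne_zero.2 (Real.sqrt_pos.2 hp).ne'
  refine Matrix.inv_eq_left_inv ?_
  ext i j
  fin_cases i <;> fin_cases j <;> simp [sec, Matrix.mul_apply, Fin.sum_univ_two, hs]
  ring

/-- **Size of the section**: `‖sec (z, r)‖ ≤ √r + |z|/√r + 1/√r`. [folklore] -/
theorem norm_sec_le {p : ℂ × ℝ} (hp : 0 < p.2) :
    ‖sec p‖ ≤ Real.sqrt p.2 + ‖p.1‖ / Real.sqrt p.2 + 1 / Real.sqrt p.2 := by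
  have hsq : 0 < Real.sqrt p.2 := Real.sqrt_pos.2 hp
  have hn : ‖((Real.sqrt p.2 : ℝ) : ℂ)‖ = Real.sqrt p.2 := by
    rw [Complex.norm_real, Real.norm_eq_abs, abs_of_pos hsq]
  have e00 : ‖sec p 0 0‖ = Real.sqrt p.2 := by rw [sec_apply_00, hn]
  have e01 : ‖sec p 0 1‖ = ‖p.1‖ / Real.sqrt p.2 := by rw [sec_apply_01, norm_div, hn]
  have e10 : ‖sec p 1 0‖ = 0 := by rw [sec_apply_10, norm_zero]
  have e11 : ‖sec p 1 1‖ = 1 / Real.sqrt p.2 := by rw [sec_apply_11, norm_div, norm_one, hn]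
  have h1 : 0 ≤ Real.sqrt p.2 := hsq.le
  have h2 : 0 ≤ ‖p.1‖ / Real.sqrt p.2 := div_nonneg (norm_nonneg _) h1
  have h3 : 0 ≤ 1 / Real.sqrt p.2 := div_nonneg zero_le_one h1
  refine norm_le_of_forall_row_sum_le _ (by positivity) fun i => ?_
  fin_cases i
  · change ∑ j, ‖sec p 0 j‖ ≤ _
    rw [Fin.sum_univ_two, e00, e01]
    linarith
  · change ∑ j, ‖sec p 1 j‖ ≤ _
    rw [Fin.sum_univ_two, e10, e11]
    linarith

/-- **Size of the inverse of the section**: `‖(sec (z, r))⁻¹‖ ≤ √r + |z|/√r + 1/√r`. [folklore] -/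
theorem norm_sec_inv_le {p : ℂ × ℝ} (hp : 0 < p.2) :
    ‖(sec p)⁻¹‖ ≤ Real.sqrt p.2 + ‖p.1‖ / Real.sqrt p.2 + 1 / Real.sqrt p.2 := by
  have hsq : 0 < Real.sqrt p.2 := Real.sqrt_pos.2 hp
  have hn : ‖((Real.sqrt p.2 : ℝ) : ℂ)‖ = Real.sqrt p.2 := by
    rw [Complex.norm_real, Real.norm_eq_abs, abs_of_pos hsq]
  rw [sec_inv_eq hp]
  have h1 : 0 ≤ Real.sqrt p.2 := hsq.le
  have h2 : 0 ≤ ‖p.1‖ / Real.sqrt p.2 := div_nonneg (norm_nonneg _) h1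
  have h3 : 0 ≤ 1 / Real.sqrt p.2 := div_nonneg zero_le_one h1
  refine norm_le_of_forall_row_sum_le _ (by positivity) fun i => ?_
  fin_cases i
  · change ∑ j, ‖(!![1 / ((Real.sqrt p.2 : ℝ) : ℂ), -p.1 / ((Real.sqrt p.2 : ℝ) : ℂ);
        0, ((Real.sqrt p.2 : ℝ) : ℂ)] : Mat) 0 j‖ ≤ _
    rw [Fin.sum_univ_two]
    simp only [Matrix.of_apply, Matrix.cons_val', Matrix.cons_val_zero, Matrix.cons_val_one,
      Matrix.cons_val_fin_one, norm_div, norm_one, norm_neg, hn]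
    linarith
  · change ∑ j, ‖(!![1 / ((Real.sqrt p.2 : ℝ) : ℂ), -p.1 / ((Real.sqrt p.2 : ℝ) : ℂ);
        0, ((Real.sqrt p.2 : ℝ) : ℂ)] : Mat) 1 j‖ ≤ _
    rw [Fin.sum_univ_two]
    simp only [Matrix.of_apply, Matrix.cons_val', Matrix.cons_val_zero, Matrix.cons_val_one,
      Matrix.cons_val_fin_one, norm_zero, hn]
    linarith

/-- **The section is polynomially bounded on a box**: if `A ≥ 1`, `r ≤ 2A`, `1/r ≤ 2A` and
`|z| ≤ A` then `1 + ‖sec (z, r)‖ + ‖(sec (z, r))⁻¹‖ ≤ 13 A²`. [folklore] -/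
theorem size_sec_le {p : ℂ × ℝ} (hp : 0 < p.2) {A : ℝ} (hA : 1 ≤ A) (hr : p.2 ≤ 2 * A)
    (hr' : p.2⁻¹ ≤ 2 * A) (hz : ‖p.1‖ ≤ A) :
    1 + ‖sec p‖ + ‖(sec p)⁻¹‖ ≤ 13 * A ^ 2 := by
  have hsq : 0 < Real.sqrt p.2 := Real.sqrt_pos.2 hp
  have hA0 : 0 ≤ A := zero_le_one.trans hA
  have h2A : 1 ≤ 2 * A := by linarith
  -- `√r ≤ 2A` and `1/√r ≤ 2A`
  have hsqrt : Real.sqrt p.2 ≤ 2 * A := by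
    calc Real.sqrt p.2 ≤ Real.sqrt ((2 * A) ^ 2) :=
          Real.sqrt_le_sqrt (hr.trans (by nlinarith))
      _ = 2 * A := Real.sqrt_sq (by linarith)
  have hinvsqrt : 1 / Real.sqrt p.2 ≤ 2 * A := by
    rw [one_div, ← Real.sqrt_inv]
    calc Real.sqrt p.2⁻¹ ≤ Real.sqrt ((2 * A) ^ 2) :=
          Real.sqrt_le_sqrt (hr'.trans (by nlinarith))
      _ = 2 * A := Real.sqrt_sq (by linarith)
  have hmid : ‖p.1‖ / Real.sqrt p.2 ≤ 2 * A ^ 2 := by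
    rw [div_eq_mul_one_div]
    calc ‖p.1‖ * (1 / Real.sqrt p.2) ≤ A * (2 * A) :=
          mul_le_mul hz hinvsqrt (div_nonneg zero_le_one hsq.le) hA0
      _ = 2 * A ^ 2 := by ring
  have hsec := norm_sec_le hp
  have hseci := norm_sec_inv_le hp
  have hAA : A ≤ A ^ 2 := by nlinarith
  nlinarith

/-! ### 4. The potential on a box and the primitive -/

/-- **The potential is polynomially bounded on a box.**  If `‖f (X_v) (sec q)‖ ≤ B ‖v‖ s(sec q)^k`
at all points `q` of the half-space (`s = 1 + ‖·‖ + ‖·⁻¹‖`), then at a point `p = (z, r)` with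
`r, 1/r, |z| ≤ A` (`A ≥ 1`): `‖potential f p‖ ≤ 2 · 13^k · B · A^{2k+2}` — the integrand of the
radial integral at time `t` is `(2 r_t)⁻¹ f (X_{p - j}) (sec q_t)` with `q_t` in the box
`r_t, 1/r_t ≤ 2A`, `|z_t| ≤ A` and `‖p - j‖ ≤ 2A`. [folklore] -/
theorem norm_potential_le {f : Mat →ₗ[ℝ] (Mat → V)} {B : ℝ} {k : ℕ} (hB : 0 ≤ B)
    (hf : ∀ (v : ℂ × ℝ) (q : ℂ × ℝ), 0 < q.2 →
      ‖f (Xof v) (sec q)‖ ≤ B * ‖v‖ * (1 + ‖sec q‖ + ‖(sec q)⁻¹‖) ^ k)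
    {p : ℂ × ℝ} (hp : 0 < p.2) {A : ℝ} (hA : 1 ≤ A) (hr : p.2 ≤ A) (hr' : p.2⁻¹ ≤ A)
    (hz : ‖p.1‖ ≤ A) :
    ‖potential f p‖ ≤ 2 * 13 ^ k * B * A ^ (2 * k + 2) := by
  have hA0 : 0 ≤ A := zero_le_one.trans hA
  set j : ℂ × ℝ := ((0 : ℂ), (1 : ℝ)) with hj
  set v : ℂ × ℝ := p - j with hv
  -- the tangent vector `v = (z, r - 1)` has `‖v‖ ≤ 2A`
  have hvn : ‖v‖ ≤ 2 * A := by
    rw [hv, Prod.norm_def]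
    refine max_le ?_ ?_
    · change ‖p.1 - 0‖ ≤ 2 * A
      rw [sub_zero]; linarith
    · change ‖p.2 - 1‖ ≤ 2 * A
      rw [Real.norm_eq_abs, abs_le]
      constructor <;> linarith [hp]
  -- the integrand bound on `[0, 1]`
  have hbound : ∀ t ∈ Ι (0 : ℝ) 1,
      ‖formAt f (j + t • v) v‖ ≤ 2 * 13 ^ k * B * A ^ (2 * k + 2) := by
    intro t ht
    rw [Set.uIoc_of_le zero_le_one] at ht
    obtain ⟨ht0, ht1⟩ := ht
    have ht0' : 0 ≤ t := ht0.le
    -- the point `q_t = (t z, 1 + t (r - 1))`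
    set q : ℂ × ℝ := j + t • v with hq
    have hq1 : q.1 = (t : ℂ) * p.1 := by
      simp only [hq, hv, hj, Prod.fst_add, Prod.smul_fst, Prod.fst_sub, sub_zero, zero_add,
        Complex.real_smul]
    have hq2 : q.2 = 1 + t * (p.2 - 1) := by
      simp only [hq, hv, hj, Prod.snd_add, Prod.smul_snd, Prod.snd_sub, smul_eq_mul]
    -- `min (1, r) ≤ q.2 ≤ max (1, r)`, hence `0 < q.2`, `q.2 ≤ 2A`, `1/q.2 ≤ 2A`
    have hq2pos : 0 < q.2 := by rw [hq2]; nlinarith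
    have hq2le : q.2 ≤ 2 * A := by rw [hq2]; nlinarith
    have hq2inv : q.2⁻¹ ≤ 2 * A := by
      -- `q.2 ≥ min(1, r)` and `1/min(1,r) ≤ max(1, 1/r) ≤ A ≤ 2A`
      rw [inv_le_comm₀ hq2pos (by linarith)]
      rw [hq2]
      have hrA : (2 * A)⁻¹ ≤ p.2 := by
        rw [inv_le_comm₀ (by linarith) hp]; linarith
      have h1A : (2 * A)⁻¹ ≤ 1 := by
        rw [inv_le_comm₀ (by linarith) one_pos, inv_one]; linarith
      -- convex combination
      have : (2 * A)⁻¹ = (1 - t) * (2 * A)⁻¹ + t * (2 * A)⁻¹ := by ring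
      rw [this]
      nlinarith [mul_le_mul_of_nonneg_left hrA ht0', mul_le_mul_of_nonneg_left h1A (sub_nonneg.2 ht1)]
    have hqz : ‖q.1‖ ≤ A := by
      rw [hq1, norm_mul, Complex.norm_real, Real.norm_eq_abs, abs_of_nonneg ht0']
      calc t * ‖p.1‖ ≤ 1 * A := mul_le_mul ht1 hz (norm_nonneg _) zero_le_one
        _ = A := one_mul A
    have hsize := size_sec_le hq2pos hA hq2le hq2inv hqz
    have hsize0 : 0 ≤ 1 + ‖sec q‖ + ‖(sec q)⁻¹‖ := by positivity
    -- the integrand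
    rw [formAt_apply, norm_smul, Real.norm_eq_abs, abs_of_pos (by positivity)]
    have hcoef : (2 * q.2)⁻¹ ≤ A := by
      rw [mul_inv]
      calc 2⁻¹ * q.2⁻¹ ≤ 2⁻¹ * (2 * A) := mul_le_mul_of_nonneg_left hq2inv (by norm_num)
        _ = A := by ring
    have hfx := hf v q hq2pos
    have hpowle : (1 + ‖sec q‖ + ‖(sec q)⁻¹‖) ^ k ≤ (13 * A ^ 2) ^ k :=
      pow_le_pow_left₀ hsize0 hsize k
    calc (2 * q.2)⁻¹ * ‖f (Xof v) (sec q)‖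
        ≤ A * (B * ‖v‖ * (1 + ‖sec q‖ + ‖(sec q)⁻¹‖) ^ k) :=
          mul_le_mul hcoef hfx (norm_nonneg _) hA0
      _ ≤ A * (B * (2 * A) * (13 * A ^ 2) ^ k) := by
          refine mul_le_mul_of_nonneg_left ?_ hA0
          exact mul_le_mul (mul_le_mul_of_nonneg_left hvn hB) hpowle (pow_nonneg hsize0 _)
            (by positivity)
      _ = 2 * 13 ^ k * B * A ^ (2 * k + 2) := by rw [mul_pow, ← pow_mul]; ring
  -- integrate over `[0, 1]`
  have hint := intervalIntegral.norm_integral_le_of_norm_le_const hbound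
  rw [sub_zero, abs_one, mul_one] at hint
  exact hint

/-- **Growth of the primitive.**  If the cochain has polynomial growth,
`‖f (X_v) M'‖ ≤ B ‖v‖ s(M')^k` for all invertible `M'` and all `v ∈ ℂ × ℝ ≅ 𝔭₀`
(`s = 1 + ‖·‖ + ‖·⁻¹‖`, `B ≥ 0`), then the primitive has polynomial growth, linearly in `B`:
`‖primitive f M‖ ≤ 2 · 13^k · 4^{2k+2} · B · s(M)^{8k+8}` for every invertible `M`.
[folklore] -/
theorem norm_primitive_le {f : Mat →ₗ[ℝ] (Mat → V)} {B : ℝ} {k : ℕ} (hB : 0 ≤ B)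
    (hf : ∀ (v : ℂ × ℝ) (M' : Mat), M' ∈ Inv →
      ‖f (Xof v) M'‖ ≤ B * ‖v‖ * (1 + ‖M'‖ + ‖M'⁻¹‖) ^ k)
    {M : Mat} (hM : M ∈ Inv) :
    ‖primitive f M‖ ≤ 2 * 13 ^ k * 4 ^ (2 * k + 2) * B * (1 + ‖M‖ + ‖M⁻¹‖) ^ (8 * k + 8) := by
  set s := 1 + ‖M‖ + ‖M⁻¹‖ with hs
  have hs1 : 1 ≤ s := one_le_size M
  set A := 4 * s ^ 4 with hA
  have hA1 : 1 ≤ A := by rw [hA]; nlinarith [one_le_pow₀ (n := 4) hs1]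
  have hA0 : 0 < A := one_pos.trans_le hA1
  have hp : 0 < (proj M).2 := proj_snd_pos M
  have hr : (proj M).2 ≤ A := proj_snd_le_size hM
  have hr' : ((proj M).2)⁻¹ ≤ A := by
    rw [inv_le_comm₀ hp hA0]
    have h := one_le_size_mul_proj_snd hM
    rw [← hA] at h
    rw [inv_le_iff_one_le_mul₀ hA0]
    linarith
  have hz : ‖(proj M).1‖ ≤ A := norm_proj_fst_le_size hM
  have hf' : ∀ (v : ℂ × ℝ) (q : ℂ × ℝ), 0 < q.2 →
      ‖f (Xof v) (sec q)‖ ≤ B * ‖v‖ * (1 + ‖sec q‖ + ‖(sec q)⁻¹‖) ^ k :=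
    fun v q hq => hf v (sec q) (isUnit_det_sec hq)
  have hpot := norm_potential_le hB hf' hp hA1 hr hr' hz
  calc ‖primitive f M‖ = ‖potential f (proj M)‖ := rfl
    _ ≤ 2 * 13 ^ k * B * A ^ (2 * k + 2) := hpot
    _ = 2 * 13 ^ k * 4 ^ (2 * k + 2) * B * s ^ (8 * k + 8) := by
        rw [hA, mul_pow, ← pow_mul]
        ring_nf

/-- **Growth of the primitive, packaged**: constants `κ, N ≥ 0` depending only on the exponent `k`
such that every cochain with `‖f (X_v) M'‖ ≤ B ‖v‖ s(M')^k` has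
`‖primitive f M‖ ≤ κ B s(M)^N` — uniformly in `f` and `B` (so a family of cochains with a common
bound has primitives with a common bound). [folklore] -/
theorem exists_norm_primitive_le (k : ℕ) :
    ∃ (κ : ℝ) (N : ℕ), 0 ≤ κ ∧ ∀ (f : Mat →ₗ[ℝ] (Mat → V)) (B : ℝ), 0 ≤ B →
      (∀ (v : ℂ × ℝ) (M' : Mat), M' ∈ Inv →
        ‖f (Xof v) M'‖ ≤ B * ‖v‖ * (1 + ‖M'‖ + ‖M'⁻¹‖) ^ k) →
      ∀ M : Mat, M ∈ Inv → ‖primitive f M‖ ≤ κ * B * (1 + ‖M‖ + ‖M⁻¹‖) ^ N :=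
  ⟨2 * 13 ^ k * 4 ^ (2 * k + 2), 8 * k + 8, by positivity,
    fun _ _ hB hf _ hM => norm_primitive_le hB hf hM⟩

/-! ### 5. Reductions of the hypothesis: a spanning set of `𝔭₀`; entrywise sizes -/

/-- `v = (Re v_z) (1, 0) + (Im v_z) (i, 0) + v_r (0, 1)` in `ℂ × ℝ`. [folklore] -/
theorem prod_eq_smul_add (v : ℂ × ℝ) :
    v = v.1.re • ((1 : ℂ), (0 : ℝ)) + v.1.im • ((I : ℂ), (0 : ℝ)) + v.2 • ((0 : ℂ), (1 : ℝ)) := by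
  refine Prod.ext ?_ ?_
  · simp only [Prod.fst_add, Prod.smul_fst, Complex.real_smul, mul_one, mul_zero, add_zero]
    exact (Complex.re_add_im v.1).symm
  · simp

/-- **From three cochains to all of `𝔭₀`.**  If the three values `f (X_e)` at the basis
`e = (1, 0), (i, 0), (0, 1)` of `ℂ × ℝ ≅ 𝔭₀` are bounded by `B s(M')^k`, then
`‖f (X_v) M'‖ ≤ 3B ‖v‖ s(M')^k` for every `v` (`f` and `X` are real-linear). [folklore] -/
theorem cochain_bound_of_basis {f : Mat →ₗ[ℝ] (Mat → V)} {B : ℝ} {k : ℕ}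
    (h₁ : ∀ M' ∈ Inv, ‖f (Xof ((1 : ℂ), (0 : ℝ))) M'‖ ≤ B * (1 + ‖M'‖ + ‖M'⁻¹‖) ^ k)
    (h₂ : ∀ M' ∈ Inv, ‖f (Xof ((I : ℂ), (0 : ℝ))) M'‖ ≤ B * (1 + ‖M'‖ + ‖M'⁻¹‖) ^ k)
    (h₃ : ∀ M' ∈ Inv, ‖f (Xof ((0 : ℂ), (1 : ℝ))) M'‖ ≤ B * (1 + ‖M'‖ + ‖M'⁻¹‖) ^ k)
    (v : ℂ × ℝ) {M' : Mat} (hM' : M' ∈ Inv) :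
    ‖f (Xof v) M'‖ ≤ 3 * B * ‖v‖ * (1 + ‖M'‖ + ‖M'⁻¹‖) ^ k := by
  set S := (1 + ‖M'‖ + ‖M'⁻¹‖) ^ k with hS
  have hS0 : 0 ≤ S := pow_nonneg (zero_le_one.trans (one_le_size M')) k
  have hB : 0 ≤ B := by
    have := (norm_nonneg _).trans (h₁ M' hM')
    have hS1 : 0 < S := pow_pos (one_pos.trans_le (one_le_size M')) k
    nlinarith
  -- expand `f (X_v)` along the basis
  have hexp : f (Xof v) M' = v.1.re • f (Xof ((1 : ℂ), (0 : ℝ))) M' +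
      v.1.im • f (Xof ((I : ℂ), (0 : ℝ))) M' + v.2 • f (Xof ((0 : ℂ), (1 : ℝ))) M' := by
    conv_lhs => rw [prod_eq_smul_add v]
    rw [Xof_add, Xof_add, Xof_smul, Xof_smul, Xof_smul, coch_add, coch_add, coch_smul, coch_smul,
      coch_smul]
  -- the three coefficients are bounded by `‖v‖`
  have hv1 : |v.1.re| ≤ ‖v‖ := (Complex.abs_re_le_norm v.1).trans (norm_fst_le v)
  have hv2 : |v.1.im| ≤ ‖v‖ := (Complex.abs_im_le_norm v.1).trans (norm_fst_le v)
  have hv3 : |v.2| ≤ ‖v‖ := by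
    have := norm_snd_le v
    rwa [Real.norm_eq_abs] at this
  rw [hexp]
  calc ‖v.1.re • f (Xof ((1 : ℂ), (0 : ℝ))) M' + v.1.im • f (Xof ((I : ℂ), (0 : ℝ))) M' +
        v.2 • f (Xof ((0 : ℂ), (1 : ℝ))) M'‖
      ≤ ‖v.1.re • f (Xof ((1 : ℂ), (0 : ℝ))) M'‖ + ‖v.1.im • f (Xof ((I : ℂ), (0 : ℝ))) M'‖ +
          ‖v.2 • f (Xof ((0 : ℂ), (1 : ℝ))) M'‖ := norm_add₃_le
    _ = |v.1.re| * ‖f (Xof ((1 : ℂ), (0 : ℝ))) M'‖ + |v.1.im| * ‖f (Xof ((I : ℂ), (0 : ℝ))) M'‖ +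
          |v.2| * ‖f (Xof ((0 : ℂ), (1 : ℝ))) M'‖ := by
        rw [norm_smul, norm_smul, norm_smul, Real.norm_eq_abs, Real.norm_eq_abs, Real.norm_eq_abs]
    _ ≤ ‖v‖ * (B * S) + ‖v‖ * (B * S) + ‖v‖ * (B * S) := by
        refine add_le_add (add_le_add ?_ ?_) ?_
        · exact mul_le_mul hv1 (h₁ M' hM') (norm_nonneg _) (norm_nonneg _)
        · exact mul_le_mul hv2 (h₂ M' hM') (norm_nonneg _) (norm_nonneg _)
        · exact mul_le_mul hv3 (h₃ M' hM') (norm_nonneg _) (norm_nonneg _)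
    _ = 3 * B * ‖v‖ * S := by ring

/-- **Entrywise form of the growth of the primitive.**  With the entrywise size
`H ≥ max (1, |M_{ij}|, |(M⁻¹)_{ij}|)` (the archimedean height of `M`) one has `s(M) ≤ 5 H`
(`‖M‖ ≤ 2H` for a `2 × 2` matrix), so under the hypothesis of `norm_primitive_le`:
`‖primitive f M‖ ≤ 2 · 13^k · 4^{2k+2} · 5^{8k+8} · B · H^{8k+8}`. [folklore] -/
theorem norm_primitive_le_of_entry_le {f : Mat →ₗ[ℝ] (Mat → V)} {B : ℝ} {k : ℕ} (hB : 0 ≤ B)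
    (hf : ∀ (v : ℂ × ℝ) (M' : Mat), M' ∈ Inv →
      ‖f (Xof v) M'‖ ≤ B * ‖v‖ * (1 + ‖M'‖ + ‖M'⁻¹‖) ^ k)
    {M : Mat} (hM : M ∈ Inv) {H : ℝ} (hH : 1 ≤ H) (hMH : ∀ i j, ‖M i j‖ ≤ H)
    (hMH' : ∀ i j, ‖M⁻¹ i j‖ ≤ H) :
    ‖primitive f M‖ ≤
      2 * 13 ^ k * 4 ^ (2 * k + 2) * 5 ^ (8 * k + 8) * B * H ^ (8 * k + 8) := by
  have hH0 : 0 ≤ H := zero_le_one.trans hH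
  have h1 : ‖M‖ ≤ 2 * H := norm_le_two_mul_of_entry_le M hH0 hMH
  have h2 : ‖M⁻¹‖ ≤ 2 * H := norm_le_two_mul_of_entry_le M⁻¹ hH0 hMH'
  have hs : 1 + ‖M‖ + ‖M⁻¹‖ ≤ 5 * H := by linarith
  have hs0 : 0 ≤ 1 + ‖M‖ + ‖M⁻¹‖ := zero_le_one.trans (one_le_size M)
  have hmain := norm_primitive_le hB hf hM
  have hpow : (1 + ‖M‖ + ‖M⁻¹‖) ^ (8 * k + 8) ≤ (5 * H) ^ (8 * k + 8) :=
    pow_le_pow_left₀ hs0 hs _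
  calc ‖primitive f M‖ ≤ 2 * 13 ^ k * 4 ^ (2 * k + 2) * B * (1 + ‖M‖ + ‖M⁻¹‖) ^ (8 * k + 8) := hmain
    _ ≤ 2 * 13 ^ k * 4 ^ (2 * k + 2) * B * (5 * H) ^ (8 * k + 8) :=
        mul_le_mul_of_nonneg_left hpow (by positivity)
    _ = 2 * 13 ^ k * 4 ^ (2 * k + 2) * 5 ^ (8 * k + 8) * B * H ^ (8 * k + 8) := by
        rw [mul_pow]; ring

end GL2C

end Literature.NumberTheory.Automorphic

end
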